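import Literature.Analysis.FluidPDE.NSSuitableESSPressureProofs
import Literature.Analysis.FluidPDE.LerayHopfH1Test
import HarnessLib

/-!
# The associated pressure of an arbitrary Leray–Hopf solution on `ℝ³`

Analysis/FluidPDE proof file (theorems only, no new definitions or facts). The tree proves the
"associated pressure" of Escauriaza–Seregin–Šverák 2003, §3, (3.2)–(3.4) for Leray–Hopf solutions
in `L_{3,∞}(Q_T)` (`ess_associated_pressure_holds`, `NSSuitableESSPressureProofs.lean`): the Riesz
pressure `p(t) = Σᵢⱼ ℛᵢℛⱼ(uᵢuⱼ)(t)` makes `(u, p)` a distributional solution on the open strip.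
Inspection of that proof shows that the hypothesis `u ∈ L^∞(0, T; L³)` is used only to place `u`
in `L³((0, T) × ℝ³)` (and to put `p` in `L^∞_t L^{3/2}_x`). Every Leray–Hopf weak solution in
dimension three lies in `L³((0, T) × ℝ³)` — `‖u‖₃ ≤ ‖u‖₂^{1/2} ‖u‖₆^{1/2}`, `‖u‖₆ ≤ K ‖∇u‖₂`
(Robinson–Rodrigo–Sadowski 2016, Thm. 1.5, Thm. 1.7 and Lemma 3.5: `u ∈ L^r(0,T; L^s)` for
`2/r + 3/s = 3/2`, here `r = s = 3` after Hölder in time) — so the same construction gives, for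
**every** Leray–Hopf weak solution of the unforced Cauchy problem on `ℝ³ × [0, T)`, a pressure
`p ∈ L^{3/2}((0, T) × ℝ³)` with `(u, p)` solving the Navier–Stokes equations in the sense of
distributions on `(0, T) × ℝ³` (Caffarelli–Kohn–Nirenberg (2.1)–(2.5) form,
`IsDistributionalNSSolutionOn`), `‖p(t)‖_{3/2} ≤ C ‖u(t)‖₃²` and the weak pressure Poisson
equation slice-wise (Lemarié-Rieusset 2016, Prop. 6.5 with Def. 6.9: a very weak solution in
`L²_t L²((1+|x|)⁻⁴ dx) ⊃ L^∞_t L²_x` is an Oseen solution, `p = Σ ℛᵢℛⱼ(uᵢuⱼ)`; Sohr 2001, Ch. V,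
Thm. 1.7.1: the associated pressure of a weak solution).

* `IsLerayHopfOn.lintegral_eLpNorm_three_rpow_lt_top` — `∫₀ᵀ ‖u(t)‖₃³ dt < ∞` in dimension `3`
  (given a jointly measurable weak-gradient witness of finite dissipation, which every Leray–Hopf
  solution has: `IsLerayHopfOn.exists_measurable_weakGradient`);
* `IsLerayHopfOn.memLp_three_uncurry_slab` — `u ∈ L³((0, T) × ℝ³)` (Tonelli);
* `IsLerayHopfOn.exists_associated_pressure` — the pressure, for the unforced problem on `ℝ³`.

This is the pressure ingredient of the restarting hypothesis `hLE` of
`BarkerPrange2020_thm2_of_localizedSmoothing` (`BarkerPrangeConcentrationProofs.lean`).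

## Mathlib / tree search

Tree (all used): `IsLerayHopfOn`, `IsWeakNSSolutionOn`, `eLpNorm_le_of_hasWeakGradient`,
`measurable_lintegral_frobeniusNormSq`, `IsLerayHopfOn.exists_measurable_weakGradient`,
`eEnergy_eq_eLpNorm_sq` (`LerayHopfH1Test`, `LerayHopfSpatialGradient`, `LerayHopfProofs`);
`exists_spaceTime_rieszPressure_of_memLp`, `volume_restrict_slab_eq_prod₃`,
`lintegral_enorm_rpow_three_eq_eLpNorm_rpow` (`RieszPressureSpaceTimeLp`);
`isDistributionalNSSolutionOn_slab_of_veryWeak`, `locallyIntegrableOn_slab_of_memLp`,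
`memLp_norm_sq_of_memLp_three` (`VeryWeakToDistributional`);
`IsWeakNSSolutionOn.setIntegral_slab_inner_gradient_eq_zero`,
`IsWeakNSSolutionOn.setIntegral_slab_veryWeak_eq_zero`,
`setIntegral_slab_pressure_mul_laplacian_eq_of_slices` (`NSSuitableESSPressureProofs`).
`lean search 'exists_.*[pP]ressure'`: only the `L_{3,∞}` fact, the Kato-class slab pressure
(`kato_distributional_slab`) and the torus version (`DuchonRobertPressure`). Mathlib:
`lintegral_prod`, `ENNReal.rpow_le_one_add_self` (tree), `ENNReal.rpow_lt_top_iff_of_pos`.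

## References

* L. Escauriaza, G. Seregin, V. Šverák, Russ. Math. Surveys 58:2 (2003) 211–250, §3, proof of
  Thm. 1.3, (3.2)–(3.4). [EscauriazaSereginSverak2003]
* J. C. Robinson, J. L. Rodrigo, W. Sadowski, *The Three-Dimensional Navier–Stokes Equations*
  (CUP 2016), Thm. 1.5, Thm. 1.7, Lemma 3.5, Lemma 5.1 and Prop. 5.3 (the pressure of a weak
  solution on the torus). [RobinsonRodrigoSadowski2016]
* P. G. Lemarié-Rieusset, *The Navier–Stokes Problem in the 21st Century* (2016), Def. 6.2,
  Prop. 6.5 with Def. 6.9. [LemarieRieusset2016]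
-/

noncomputable section

open MeasureTheory TopologicalSpace Set Function Filter Topology Metric InnerProductSpace
open scoped ENNReal NNReal RealInnerProductSpace Laplacian

namespace Literature.Analysis.FluidPDE

/-! ### `u ∈ L³((0, T) × E)` for Leray–Hopf solutions in dimension three -/

section SliceBound

variable {E : Type*} [NormedAddCommGroup E] [InnerProductSpace ℝ E] [FiniteDimensional ℝ E]
  [MeasurableSpace E] [BorelSpace E]
variable {T ν : ℝ} {u₀ : E → E} {u : ℝ → E → E}

/-- **`∫₀ᵀ ‖u(t)‖₃³ dt < ∞` for a Leray–Hopf solution in dimension `3`** with a jointly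
measurable weak-gradient witness of finite dissipation (Robinson–Rodrigo–Sadowski 2016,
Lemma 3.5-type bound, `u ∈ L³(0,T;L³)` by `2/3 + 3/3 = 3/2` up to Hölder in time):
`‖u‖₃³ ≤ ‖u‖₂^{3/2} ‖u‖₆^{3/2} ≤ K ‖∇u‖₂^{3/2}` (`eLpNorm_le_of_hasWeakGradient` at `p = 3`) and
`x^{3/4} ≤ 1 + x`. [cite: RobinsonRodrigoSadowski2016, Lemma 3.5 (with Thm. 1.5, Thm. 1.7)] -/
theorem IsLerayHopfOn.lintegral_eLpNorm_three_rpow_lt_top (hE3 : Module.finrank ℝ E = 3)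
    {f : ℝ → E → E} (hu : IsLerayHopfOn T ν f u₀ u) {G : ℝ → E → E →L[ℝ] E}
    (hGm : StronglyMeasurable (uncurry G))
    (hG : ∀ᵐ t ∂(volume.restrict (Ioo 0 T)), HasWeakGradient (u t) (G t))
    (hG2 : ∫⁻ t in Ioo 0 T, ∫⁻ x, ENNReal.ofReal (frobeniusNormSq (G t x)) < ⊤) :
    ∫⁻ s in Ioo 0 T, eLpNorm (u s) 3 volume ^ (3 : ℝ) < ⊤ := by
  obtain ⟨K, hK⟩ := hu.energy_bound
  set Cs : ℝ≥0∞ := (SNormLESNormFDerivOfEqConst E (volume : Measure E) 2 : ℝ≥0∞) with hCs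
  set D : ℝ → ℝ≥0∞ := fun s => ∫⁻ x, ENNReal.ofReal (frobeniusNormSq (G s x)) with hD
  have hDm : Measurable D := measurable_lintegral_frobeniusNormSq hGm
  -- pointwise bound for a.e. `s`
  have hpt : ∀ᵐ s ∂(volume.restrict (Ioo 0 T)),
      eLpNorm (u s) 3 volume ^ (3 : ℝ) ≤
        (K : ℝ≥0∞) ^ (3 / 4 : ℝ) * Cs ^ (3 / 2 : ℝ) * (1 + D s) := by
    filter_upwards [hK, hG, ae_restrict_mem measurableSet_Ioo] with s hKs hGs hsI
    have hmem : MemLp (u s) 2 volume := hu.memLp s (Ioo_subset_Icc_self hsI)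
    have h1 := eLpNorm_le_of_hasWeakGradient hE3 hmem hGs (p := 3) (by norm_num) (by norm_num)
    have h3 : (3 : ℝ≥0∞).toReal = 3 := ENNReal.toReal_ofNat 3
    rw [h3] at h1
    norm_num at h1
    -- `‖u‖₂ ≤ K^{1/2}`
    have h2 : eLpNorm (u s) 2 volume ≤ (K : ℝ≥0∞) ^ (1 / 2 : ℝ) := by
      rw [eEnergy_eq_eLpNorm_sq] at hKs
      calc eLpNorm (u s) 2 volume = (eLpNorm (u s) 2 volume ^ 2) ^ (1 / 2 : ℝ) := by
            rw [← ENNReal.rpow_natCast, ← ENNReal.rpow_mul]; norm_num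
        _ ≤ (K : ℝ≥0∞) ^ (1 / 2 : ℝ) := ENNReal.rpow_le_rpow hKs (by norm_num)
    have e1 : ∀ x : ℝ≥0∞, (x ^ (1 / 2 : ℝ)) ^ (3 : ℝ) = x ^ (3 / 2 : ℝ) := fun x => by
      rw [← ENNReal.rpow_mul]; norm_num
    have e2 : ∀ x : ℝ≥0∞, ((x ^ (1 / 2 : ℝ)) ^ (1 / 2 : ℝ)) ^ (3 : ℝ) = x ^ (3 / 4 : ℝ) :=
      fun x => by
      rw [← ENNReal.rpow_mul, ← ENNReal.rpow_mul]; norm_num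
    calc eLpNorm (u s) 3 volume ^ (3 : ℝ)
        ≤ (eLpNorm (u s) 2 volume ^ (1 / 2 : ℝ) * (Cs * D s ^ (1 / 2 : ℝ)) ^ (1 / 2 : ℝ)) ^ (3 : ℝ) :=
          ENNReal.rpow_le_rpow h1 (by norm_num)
      _ = eLpNorm (u s) 2 volume ^ (3 / 2 : ℝ) * Cs ^ (3 / 2 : ℝ) * D s ^ (3 / 4 : ℝ) := by
          rw [ENNReal.mul_rpow_of_nonneg _ _ (by norm_num : (0 : ℝ) ≤ 3),
            ENNReal.mul_rpow_of_nonneg _ _ (by norm_num : (0 : ℝ) ≤ 1 / 2),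
            ENNReal.mul_rpow_of_nonneg _ _ (by norm_num : (0 : ℝ) ≤ 3), e2, e1, e1]
          ring
      _ ≤ ((K : ℝ≥0∞) ^ (1 / 2 : ℝ)) ^ (3 / 2 : ℝ) * Cs ^ (3 / 2 : ℝ) * (1 + D s) := by
          gcongr
          all_goals first
            | exact h2
            | exact ENNReal.rpow_le_one_add_self _ (by norm_num) (by norm_num)
      _ = (K : ℝ≥0∞) ^ (3 / 4 : ℝ) * Cs ^ (3 / 2 : ℝ) * (1 + D s) := by
          rw [← ENNReal.rpow_mul, show (1 : ℝ) / 2 * (3 / 2) = 3 / 4 by norm_num]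
  calc ∫⁻ s in Ioo 0 T, eLpNorm (u s) 3 volume ^ (3 : ℝ)
      ≤ ∫⁻ s in Ioo 0 T, (K : ℝ≥0∞) ^ (3 / 4 : ℝ) * Cs ^ (3 / 2 : ℝ) * (1 + D s) :=
        lintegral_mono_ae hpt
    _ = (K : ℝ≥0∞) ^ (3 / 4 : ℝ) * Cs ^ (3 / 2 : ℝ) *
          (volume (Ioo 0 T) + ∫⁻ s in Ioo 0 T, D s) := by
        rw [lintegral_const_mul _ (hDm.const_add 1), lintegral_add_left measurable_const,
          lintegral_const, Measure.restrict_apply_univ, one_mul]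
    _ < ⊤ := by
        refine ENNReal.mul_lt_top (ENNReal.mul_lt_top ?_ ?_) (ENNReal.add_lt_top.2 ⟨?_, hG2⟩)
        · exact ENNReal.rpow_lt_top_of_nonneg (by norm_num) ENNReal.coe_ne_top
        · exact ENNReal.rpow_lt_top_of_nonneg (by norm_num) ENNReal.coe_ne_top
        · rw [Real.volume_Ioo]; exact ENNReal.ofReal_lt_top

end SliceBound

/-! ### The pressure on `ℝ³` -/

section Pressure

variable {T ν : ℝ} {f : ℝ → EuclideanSpace ℝ (Fin 3) → EuclideanSpace ℝ (Fin 3)}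
  {u₀ : EuclideanSpace ℝ (Fin 3) → EuclideanSpace ℝ (Fin 3)}
  {u : ℝ → EuclideanSpace ℝ (Fin 3) → EuclideanSpace ℝ (Fin 3)}

/-- **Every Leray–Hopf weak solution on `ℝ³ × [0, T)` lies in `L³((0, T) × ℝ³)`**
(Robinson–Rodrigo–Sadowski 2016, Lemma 3.5; Tonelli over a jointly measurable version, with the
jointly measurable weak-gradient witness `IsLerayHopfOn.exists_measurable_weakGradient`).
[cite: RobinsonRodrigoSadowski2016, Lemma 3.5] -/
theorem IsLerayHopfOn.memLp_three_uncurry_slab (hu : IsLerayHopfOn T ν f u₀ u) :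
    MemLp (uncurry u) 3
      (volume.restrict (Ioo 0 T ×ˢ (univ : Set (EuclideanSpace ℝ (Fin 3))))) := by
  have hm : AEStronglyMeasurable (uncurry u)
      (volume.restrict (Ioo 0 T ×ˢ (univ : Set (EuclideanSpace ℝ (Fin 3))))) := hu.weak.1
  obtain ⟨G, hGm, hG, hG2, -⟩ := hu.exists_measurable_weakGradient
  have h3 := hu.lintegral_eLpNorm_three_rpow_lt_top finrank_euclideanSpace_fin hGm hG hG2
  refine ⟨hm, ?_⟩
  have hm' : AEStronglyMeasurable (uncurry u)
      ((volume.restrict (Ioo 0 T)).prod (volume : Measure (EuclideanSpace ℝ (Fin 3)))) := by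
    rw [← volume_restrict_slab_eq_prod₃]; exact hm
  have h : ∫⁻ z in Ioo 0 T ×ˢ (univ : Set (EuclideanSpace ℝ (Fin 3))),
      ‖uncurry u z‖ₑ ^ (3 : ℝ) < ⊤ := by
    rw [volume_restrict_slab_eq_prod₃, lintegral_prod _ (hm'.enorm.pow_const _)]
    calc ∫⁻ t in Ioo 0 T, ∫⁻ x, ‖uncurry u (t, x)‖ₑ ^ (3 : ℝ)
        = ∫⁻ t in Ioo 0 T, eLpNorm (u t) 3 volume ^ (3 : ℝ) :=
          lintegral_congr fun t => lintegral_enorm_rpow_three_eq_eLpNorm_rpow _ (u t)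
      _ < ⊤ := h3
  rw [lintegral_enorm_rpow_three_eq_eLpNorm_rpow] at h
  exact (ENNReal.rpow_lt_top_iff_of_pos (by norm_num)).1 h

/-- **The associated pressure of a Leray–Hopf solution** (Escauriaza–Seregin–Šverák 2003, §3,
(3.2)–(3.4), "using known Ladyzhenskaya's arguments ... we can introduce the so-called
associated pressure"; here for an *arbitrary* Leray–Hopf weak solution of the unforced Cauchy
problem on `ℝ³ × [0, T)`, `T > 0`, with `L^{3/2}` in place of `L_{3/2,∞}`). There is a pressure
`p ∈ L^{3/2}((0, T) × ℝ³)` such that `(u, p)` solves the Navier–Stokes equations with viscosity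
`ν` (no force) in the sense of distributions on the open strip `(0, T) × ℝ³`
(`IsDistributionalNSSolutionOn` on `slab`), and for a.e. `t ∈ (0, T)` the slice `p(t)` is in
`L^{3/2}` with Stein's bound `‖p(t)‖_{3/2} ≤ C_{3/2} ‖u(t)‖₃²` and solves the weak pressure
Poisson equation `∫ p(t) Δφ = -∫ D²φ(u(t), u(t))` for all test functions `φ` — it is the Riesz
pressure `Σᵢⱼ ℛᵢℛⱼ(uᵢuⱼ)` (Lemarié-Rieusset 2016, Prop. 6.5 with Def. 6.9). Proof: `u ∈ L³` of the
slab (`memLp_three_uncurry_slab`), the jointly measurable space–time Riesz pressure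
(`exists_spaceTime_rieszPressure_of_memLp`), and the passage from the very weak equations to the
pressure-explicit system (`isDistributionalNSSolutionOn_slab_of_veryWeak`), exactly as in
`ess_associated_pressure_holds`. [cite: EscauriazaSereginSverak2003, §3, proof of Thm. 1.3, (3.2)–(3.4)]
[cite: LemarieRieusset2016, Prop. 6.5 with Def. 6.9 (file p. 136)] -/
theorem IsLerayHopfOn.exists_associated_pressure (hT : 0 < T) (hLH : IsLerayHopfOn T ν 0 u₀ u) :
    ∃ p : ℝ → EuclideanSpace ℝ (Fin 3) → ℝ,
      MemLp (uncurry p) (3 / 2 : ℝ≥0∞)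
        (volume.restrict (Ioo 0 T ×ˢ (univ : Set (EuclideanSpace ℝ (Fin 3))))) ∧
      IsDistributionalNSSolutionOn (slab (EuclideanSpace ℝ (Fin 3)) (Ioo 0 T) isOpen_Ioo) ν 0 u p ∧
      ∀ᵐ t ∂(volume.restrict (Ioo 0 T)),
        MemLp (p t) (3 / 2 : ℝ≥0∞) volume ∧
        eLpNorm (p t) (3 / 2 : ℝ≥0∞) volume ≤ steinConstThreeHalves * eLpNorm (u t) 3 volume ^ 2 ∧
        ∀ φ : EuclideanSpace ℝ (Fin 3) → ℝ, ContDiff ℝ (⊤ : ℕ∞) φ → HasCompactSupport φ →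
          ∫ x, p t x * (Δ φ) x = -∫ x, fderiv ℝ (fderiv ℝ φ) x (u t x) (u t x) := by
  have h32 : (1 : ℝ≥0∞) ≤ 3 / 2 := by
    rw [ENNReal.le_div_iff_mul_le (Or.inl two_ne_zero) (Or.inl ENNReal.ofNat_ne_top)]; norm_num
  have hw : IsWeakNSSolutionOn T ν 0 u₀ u := hLH.weak
  have hu3 := hLH.memLp_three_uncurry_slab
  have hu1 := locallyIntegrableOn_slab_of_memLp hu3 (by norm_num)
  have hu2 := locallyIntegrableOn_slab_of_memLp (memLp_norm_sq_of_memLp_three hu3) h32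
  obtain ⟨p, -, hp32, hsl⟩ := exists_spaceTime_rieszPressure_of_memLp hT hu3
  have hp1 := locallyIntegrableOn_slab_of_memLp hp32 h32
  refine ⟨p, hp32, ?_, hsl.mono fun t ht => ⟨ht.2.2.1, ht.2.2.2.1, ht.2.2.2.2⟩⟩
  exact isDistributionalNSSolutionOn_slab_of_veryWeak hu3 hp32
    (fun θ hθ => hw.setIntegral_slab_inner_gradient_eq_zero hu1 hθ)
    (fun θ hθ => setIntegral_slab_pressure_mul_laplacian_eq_of_slices hu1 hu2 hp1
      (hsl.mono fun t ht => ht.2.2.2.2) hθ)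
    (fun ψ hψ hdivψ => hw.setIntegral_slab_veryWeak_eq_zero hu1 hu2 hψ hdivψ)

end Pressure

end Literature.Analysis.FluidPDE

end
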